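import Summits.SmoothPoincare4.SmoothPoincare4.Theorems.SullivanDualWitnessChargeDefs
import Mathlib.Topology.OpenPartialHomeomorph.Constructions

/-!
# Sub-stub `substub_flatChart` of the hard stub `stub_pencilOrRescale`: the flat end chart
(crux `WitnessCharge`, stmt-SmoothPoincare4-7824, route `SullivanDual`, line `Sketch`;
card `Cruxes/WitnessCharge/Lines/Sketch.md`)

The complex flat coordinates `Ycoord p x = (y₀ + i y₁, y₂ + i y₃)`, `y = ι(e x − e p)`
(`SullivanDualWitnessChargeDefs.lean`), packaged as an honest chart of the end: an
`OpenPartialHomeomorph Φ : Σ∖p ⇀ ℂ × ℂ` with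

* source the punctured `ε'`-chart-ball `{x | InPuncturedChartBall p ε' x}` and target the standard
  end `{q | ε'⁻¹ < ‖realify q‖}` of `ℂ × ℂ` (Euclidean norm of the realification, NOT the sup norm
  of `ℂ × ℂ`);
* `Φ = Ycoord p` as a total function and `Φ.symm q = e.symm (e p + ι (realify q))` on the target;
* `Φ` of class `C^∞` on the source, `Φ.symm` of class `C^∞` on the target;
* the chain rule `realify ∘ DΦ(x) = Dι(e x − e p) ∘ D(e ∘ val)(x)` on the source.

All later analytic steps of the line (confinement of pencil planes, canonical parametrisation,
rescaling limits) are phrased in these coordinates. The proof follows the template of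
`Literature.Geometry.Symplectic.gromov_recognitionR4_relEnd.chartForm` (the inverted recentred
chart `ψ = ι ∘ (e − e p)` is a diffeomorphism of the punctured chart-ball onto the standard end,
with inverse `z ↦ e.symm (e p + ι z)`; its differential `Dι(e x − e p) ∘ D(e ∘ val)(x)` is computed
as in `hasMFDerivAt_psi` of `SullivanDualWitnessChargeSubstubFar.lean`), composed with the linear
isomorphism `y ↦ (y₀ + i y₁, y₂ + i y₃)` of `ℝ⁴` onto `ℂ × ℂ` inverse to `realify`. No new
definitions: the chart is assembled inside the proof from the lemmas below, the inverse being ANY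
map with the displayed formula on the standard end.
-/

noncomputable section

-- the prescribed namespace `Summit.<P>.<Sub>.…` duplicates `SmoothPoincare4` (P = Sub)
set_option linter.dupNamespace false

open scoped Manifold ContDiff Topology
open Set Filter Literature.Geometry.Symplectic Literature.Topology.FourManifolds

namespace Summit.SmoothPoincare4.SmoothPoincare4.Theorems.WitnessCharge.PencilIncompleteness

variable {S : HomotopySphere 4}

/-! ### The coordinates of `Ycoord` invert `realify` -/

/-- The realification of `Ycoord p x` is the flat coordinate `ι(e x − e p)`. -/
theorem realify_Ycoord (p : S.carrier) (x : punctured p) :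
    realify (Ycoord p x) = inversion (extChartAt (𝓡 4) p x.1 - extChartAt (𝓡 4) p p) := by
  ext i; fin_cases i <;> rfl

/-- The coordinates of `Ycoord` come from a continuous `ℝ`-linear map `A : ℝ⁴ → ℂ × ℂ`,
`A y = (y₀ + i y₁, y₂ + i y₃)`, which is a right inverse of `realify`. -/
theorem exists_coordCLM :
    ∃ A : EuclideanSpace ℝ (Fin 4) →L[ℝ] ℂ × ℂ,
      (∀ y : EuclideanSpace ℝ (Fin 4), A y = (⟨y 0, y 1⟩, ⟨y 2, y 3⟩)) ∧
      ∀ y : EuclideanSpace ℝ (Fin 4), realify (A y) = y := by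
  refine ⟨LinearMap.toContinuousLinearMap
    { toFun := fun y => (⟨y 0, y 1⟩, ⟨y 2, y 3⟩)
      map_add' := fun a b => by
        ext <;> simp [Complex.ext_iff]
      map_smul' := fun c a => by
        ext <;> simp [Complex.ext_iff] }, fun _ => rfl, fun y => ?_⟩
  ext i; fin_cases i <;> rfl

/-! ### The standard end `{q | ε'⁻¹ < ‖realify q‖}` of `ℂ × ℂ` -/

variable {p : S.carrier} {ε' : ℝ}

/-- Points of the standard end have nonzero realification. -/
theorem realify_ne_zero_of_lt (hε' : 0 < ε') {q : ℂ × ℂ} (hq : ε'⁻¹ < ‖realify q‖) :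
    realify q ≠ 0 := by
  intro h
  rw [h, norm_zero] at hq
  exact lt_irrefl _ (hq.trans (inv_pos.2 hε'))

/-- On the standard end, `‖ι (realify q)‖ < ε'`. -/
theorem norm_inversion_realify_lt_of_lt (hε' : 0 < ε') {q : ℂ × ℂ} (hq : ε'⁻¹ < ‖realify q‖) :
    ‖inversion (realify q)‖ < ε' := by
  rw [norm_inversion]
  have hpos : 0 < ‖realify q‖ := (inv_pos.2 hε').trans hq
  exact (inv_lt_comm₀ hpos hε').2 hq

/-- The standard end is open. -/
theorem isOpen_stdEnd (ε' : ℝ) : IsOpen {q : ℂ × ℂ | ε'⁻¹ < ‖realify q‖} :=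
  isOpen_lt continuous_const (continuous_norm.comp realifyL.continuous)

/-- A far intercept: `ε'⁻¹ < ‖ε'⁻¹ + 1‖`. -/
theorem inv_lt_norm_far (hε' : 0 < ε') : ε'⁻¹ < ‖((ε'⁻¹ + 1 : ℝ) : ℂ)‖ := by
  rw [Complex.norm_real, Real.norm_of_nonneg (add_pos (inv_pos.2 hε') one_pos).le]
  exact lt_add_one _

/-! ### `Ycoord` on the punctured chart-ball: range, smoothness, differential -/

/-- On the punctured chart-ball, `e x − e p ≠ 0`. -/
theorem sub_ne_zero_of_ball {x : punctured p} (hx : InPuncturedChartBall p ε' x) :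
    extChartAt (𝓡 4) p x.1 - extChartAt (𝓡 4) p p ≠ 0 := by
  intro h0
  have h1 : extChartAt (𝓡 4) p x.1 = extChartAt (𝓡 4) p p := sub_eq_zero.1 h0
  have h2 : x.1 = p :=
    (extChartAt (𝓡 4) p).injOn (by rw [extChartAt_source]; exact hx.1)
      (mem_extChartAt_source (I := 𝓡 4) p) h1
  exact (mem_punctured.1 x.2) h2

/-- On the punctured `ε'`-chart-ball, `‖e x − e p‖ < ε'`. -/
theorem norm_sub_lt_of_ball {x : punctured p} (hx : InPuncturedChartBall p ε' x) :
    ‖extChartAt (𝓡 4) p x.1 - extChartAt (𝓡 4) p p‖ < ε' := by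
  have h := hx.2
  rwa [Metric.mem_ball, dist_eq_norm] at h

/-- `Ycoord` maps the punctured `ε'`-chart-ball into the standard end. -/
theorem Ycoord_mem_stdEnd (hε' : 0 < ε') {x : punctured p} (hx : InPuncturedChartBall p ε' x) :
    ε'⁻¹ < ‖realify (Ycoord p x)‖ := by
  rw [realify_Ycoord, norm_inversion]
  exact (inv_lt_inv₀ hε' (norm_pos_iff.2 (sub_ne_zero_of_ball hx))).2 (norm_sub_lt_of_ball hx)

/-- `Ycoord p` is `C^∞` at every point of the punctured chart-ball. -/
theorem contMDiffAt_Ycoord {x : punctured p} (hx : InPuncturedChartBall p ε' x) :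
    ContMDiffAt (𝓡 4) 𝓘(ℝ, ℂ × ℂ) ∞ (Ycoord p) x := by
  obtain ⟨A, hA, -⟩ := exists_coordCLM
  have hY : Ycoord p =
      (fun y : EuclideanSpace ℝ (Fin 4) => A (inversion (y - extChartAt (𝓡 4) p p))) ∘
        (fun z : punctured p => extChartAt (𝓡 4) p z.1) := by
    funext z
    rw [Function.comp_apply, hA]
    rfl
  have hE : ContMDiffAt (𝓡 4) 𝓘(ℝ, EuclideanSpace ℝ (Fin 4)) ∞
      (fun z : punctured p => extChartAt (𝓡 4) p z.1) x :=
    (contMDiffAt_extChartAt' (I := 𝓡 4) (n := ∞) hx.1).comp x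
      (contMDiff_subtype_val (I := 𝓡 4) (n := ∞) (U := punctured p) x)
  have hg : ContDiffAt ℝ ∞
      (fun y : EuclideanSpace ℝ (Fin 4) => A (inversion (y - extChartAt (𝓡 4) p p)))
      (extChartAt (𝓡 4) p x.1) := by
    have h1 : ContDiffAt ℝ ∞ inversion
        ((fun y : EuclideanSpace ℝ (Fin 4) => y - extChartAt (𝓡 4) p p) (extChartAt (𝓡 4) p x.1)) :=
      contDiffAt_inversion (sub_ne_zero_of_ball hx)
    have h2 : ContDiffAt ℝ ∞ (fun y : EuclideanSpace ℝ (Fin 4) => inversion (y - extChartAt (𝓡 4) p p))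
        (extChartAt (𝓡 4) p x.1) :=
      ContDiffAt.comp (g := inversion) (f := fun y : EuclideanSpace ℝ (Fin 4) => y - extChartAt (𝓡 4) p p)
        (extChartAt (𝓡 4) p x.1) h1 (contDiffAt_id.sub contDiffAt_const)
    exact ContDiffAt.comp (g := A)
      (f := fun y : EuclideanSpace ℝ (Fin 4) => inversion (y - extChartAt (𝓡 4) p p))
      (extChartAt (𝓡 4) p x.1) A.contDiff.contDiffAt h2
  rw [hY]
  exact ContDiffAt.comp_contMDiffAt
    (g := fun y : EuclideanSpace ℝ (Fin 4) => A (inversion (y - extChartAt (𝓡 4) p p)))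
    (f := fun z : punctured p => extChartAt (𝓡 4) p z.1) (x := x) hg hE

/-- `Ycoord p` is `C^∞` on the punctured `ε'`-chart-ball. -/
theorem contMDiffOn_Ycoord (p : S.carrier) (ε' : ℝ) :
    ContMDiffOn (𝓡 4) 𝓘(ℝ, ℂ × ℂ) ∞ (Ycoord p) {x : punctured p | InPuncturedChartBall p ε' x} :=
  fun _ hx => (contMDiffAt_Ycoord hx).contMDiffWithinAt

/-- The chain rule in realified form on the punctured chart-ball:
`realify (D(Ycoord p)(x) v) = Dι(e x − e p) (D(e ∘ val)(x) v)`. -/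
theorem realify_mfderiv_Ycoord {x : punctured p} (hx : InPuncturedChartBall p ε' x)
    (v : TangentSpace (𝓡 4) x) :
    realify (mfderiv (𝓡 4) 𝓘(ℝ, ℂ × ℂ) (Ycoord p) x v) =
      fderiv ℝ inversion (extChartAt (𝓡 4) p x.1 - extChartAt (𝓡 4) p p)
        (mfderiv (𝓡 4) 𝓘(ℝ, EuclideanSpace ℝ (Fin 4))
          (fun z : punctured p => extChartAt (𝓡 4) p z.1) x v) := by
  -- the differential `Dι(e x − e p) ∘ D(e ∘ val)(x)` of `ψ = ι ∘ (e ∘ val − e p)` at `x`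
  -- (adapted from the lead's `hasMFDerivAt_psi`, `SullivanDualWitnessChargeSubstubFar.lean`)
  have hψ : HasMFDerivAt (𝓡 4) 𝓘(ℝ, EuclideanSpace ℝ (Fin 4))
      (fun z : punctured p => inversion (extChartAt (𝓡 4) p z.1 - extChartAt (𝓡 4) p p)) x
      ((fderiv ℝ inversion (extChartAt (𝓡 4) p x.1 - extChartAt (𝓡 4) p p)).comp
        (mfderiv (𝓡 4) 𝓘(ℝ, EuclideanSpace ℝ (Fin 4))
          (fun z : punctured p => extChartAt (𝓡 4) p z.1) x)) := by
    have hE : MDifferentiableAt (𝓡 4) 𝓘(ℝ, EuclideanSpace ℝ (Fin 4))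
        (fun z : punctured p => extChartAt (𝓡 4) p z.1) x :=
      ((contMDiffAt_extChartAt' (I := 𝓡 4) (n := ∞) hx.1).comp x
        (contMDiff_subtype_val (I := 𝓡 4) (n := ∞) (U := punctured p) x)).mdifferentiableAt
        (by simp)
    have hg : HasFDerivAt
        (fun y : EuclideanSpace ℝ (Fin 4) => inversion (y - extChartAt (𝓡 4) p p))
        (fderiv ℝ inversion (extChartAt (𝓡 4) p x.1 - extChartAt (𝓡 4) p p))
        (extChartAt (𝓡 4) p x.1) := by
      have h1 : HasFDerivAt inversion
          (fderiv ℝ inversion (extChartAt (𝓡 4) p x.1 - extChartAt (𝓡 4) p p))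
          (extChartAt (𝓡 4) p x.1 - extChartAt (𝓡 4) p p) :=
        (differentiableAt_inversion (sub_ne_zero_of_ball hx)).hasFDerivAt
      have h2 := h1.comp (extChartAt (𝓡 4) p x.1) (hasFDerivAt_sub_const (extChartAt (𝓡 4) p p))
      rwa [ContinuousLinearMap.comp_id] at h2
    exact HasMFDerivAt.comp x
      (g := fun y : EuclideanSpace ℝ (Fin 4) => inversion (y - extChartAt (𝓡 4) p p))
      (f := fun z : punctured p => extChartAt (𝓡 4) p z.1) hg.hasMFDerivAt hE.hasMFDerivAt
  -- `Ycoord p = A ∘ ψ` for the linear isomorphism `A` inverse to `realify`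
  obtain ⟨A, hA, hAr⟩ := exists_coordCLM
  have hY : Ycoord p =
      A ∘ (fun z : punctured p => inversion (extChartAt (𝓡 4) p z.1 - extChartAt (𝓡 4) p p)) := by
    funext z
    rw [Function.comp_apply, hA]
    rfl
  have hd : HasMFDerivAt (𝓡 4) 𝓘(ℝ, ℂ × ℂ) (Ycoord p) x
      (A.comp ((fderiv ℝ inversion (extChartAt (𝓡 4) p x.1 - extChartAt (𝓡 4) p p)).comp
        (mfderiv (𝓡 4) 𝓘(ℝ, EuclideanSpace ℝ (Fin 4))
          (fun z : punctured p => extChartAt (𝓡 4) p z.1) x))) := by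
    rw [hY]
    exact HasMFDerivAt.comp x (g := A)
      (f := fun z : punctured p => inversion (extChartAt (𝓡 4) p z.1 - extChartAt (𝓡 4) p p))
      A.hasMFDerivAt hψ
  rw [hd.mfderiv]
  exact hAr _

/-! ### The inverse chart: any map `χ` with `χ q = e.symm (e p + ι (realify q))` on the standard end -/

section Inverse

variable (hε' : 0 < ε')
  (hball : Metric.closedBall (extChartAt (𝓡 4) p p) ε' ⊆ (extChartAt (𝓡 4) p).target)
include hε' hball

/-- On the standard end, `e p + ι (realify q)` lies in the chart target. -/
theorem flat_mem_target {q : ℂ × ℂ} (hq : ε'⁻¹ < ‖realify q‖) :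
    extChartAt (𝓡 4) p p + inversion (realify q) ∈ (extChartAt (𝓡 4) p).target := by
  apply hball
  rw [Metric.mem_closedBall, dist_eq_norm, add_sub_cancel_left]
  exact (norm_inversion_realify_lt_of_lt hε' hq).le

/-- On the standard end, `e.symm (e p + ι (realify q))` lies in the chart source at `p`. -/
theorem flat_symm_mem_source {q : ℂ × ℂ} (hq : ε'⁻¹ < ‖realify q‖) :
    (extChartAt (𝓡 4) p).symm (extChartAt (𝓡 4) p p + inversion (realify q)) ∈
      (chartAt (EuclideanSpace ℝ (Fin 4)) p).source := by
  rw [← extChartAt_source (I := 𝓡 4)]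
  exact (extChartAt (𝓡 4) p).map_target (flat_mem_target hε' hball hq)

/-- The chart reads `e.symm (e p + ι (realify q))` as `e p + ι (realify q)`. -/
theorem extChartAt_flat_symm {q : ℂ × ℂ} (hq : ε'⁻¹ < ‖realify q‖) :
    extChartAt (𝓡 4) p ((extChartAt (𝓡 4) p).symm (extChartAt (𝓡 4) p p + inversion (realify q))) =
      extChartAt (𝓡 4) p p + inversion (realify q) :=
  (extChartAt (𝓡 4) p).right_inv (flat_mem_target hε' hball hq)

/-- `e.symm (e p + ι (realify q)) ≠ p` on the standard end. -/
theorem flat_symm_ne {q : ℂ × ℂ} (hq : ε'⁻¹ < ‖realify q‖) :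
    (extChartAt (𝓡 4) p).symm (extChartAt (𝓡 4) p p + inversion (realify q)) ≠ p := by
  intro h
  have h1 := extChartAt_flat_symm hε' hball hq
  rw [h, left_eq_add] at h1
  exact inversion_ne_zero (realify_ne_zero_of_lt hε' hq) h1

/-- There is a map `χ : ℂ × ℂ → Σ ∖ p` with `χ q = e.symm (e p + ι (realify q))` on the standard end
(a fixed far point elsewhere). -/
theorem exists_flatInv :
    ∃ χ : ℂ × ℂ → punctured p, ∀ q : ℂ × ℂ, ε'⁻¹ < ‖realify q‖ →
      (χ q).1 = (extChartAt (𝓡 4) p).symm (extChartAt (𝓡 4) p p + inversion (realify q)) := by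
  classical
  refine ⟨fun q => if hq : ε'⁻¹ < ‖realify q‖ then
      ⟨(extChartAt (𝓡 4) p).symm (extChartAt (𝓡 4) p p + inversion (realify q)),
        mem_punctured.2 (flat_symm_ne hε' hball hq)⟩
    else farLine hε' hball (inv_lt_norm_far hε') 0, fun q hq => ?_⟩
  simp only [dif_pos hq]

/-- The flat map `q ↦ e.symm (e p + ι (realify q))` is `C^∞` on the standard end (into `Σ`). -/
theorem contMDiffOn_flat_symm :
    ContMDiffOn 𝓘(ℝ, ℂ × ℂ) (𝓡 4) ∞
      (fun q : ℂ × ℂ => (extChartAt (𝓡 4) p).symm (extChartAt (𝓡 4) p p + inversion (realify q)))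
      {q : ℂ × ℂ | ε'⁻¹ < ‖realify q‖} := by
  have h1 : ContMDiffOn 𝓘(ℝ, ℂ × ℂ) 𝓘(ℝ, EuclideanSpace ℝ (Fin 4)) ∞
      (fun q : ℂ × ℂ => extChartAt (𝓡 4) p p + inversion (realify q))
      {q : ℂ × ℂ | ε'⁻¹ < ‖realify q‖} := by
    intro q hq
    have h2 : ContDiffAt ℝ ∞ (fun q : ℂ × ℂ => inversion (realify q)) q :=
      ContDiffAt.comp (g := inversion) (f := fun q : ℂ × ℂ => realify q) q
        (contDiffAt_inversion (realify_ne_zero_of_lt hε' hq)) realifyL.contDiff.contDiffAt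
    exact (contDiffAt_const.add h2).contMDiffAt.contMDiffWithinAt
  exact (contMDiffOn_extChartAt_symm (I := 𝓡 4) (n := ∞) p).comp h1
    (fun q hq => flat_mem_target hε' hball hq)

variable {χ : ℂ × ℂ → punctured p}
  (hχ : ∀ q : ℂ × ℂ, ε'⁻¹ < ‖realify q‖ →
    (χ q).1 = (extChartAt (𝓡 4) p).symm (extChartAt (𝓡 4) p p + inversion (realify q)))
include hχ

/-- Such a `χ` maps the standard end into the punctured `ε'`-chart-ball. -/
theorem flatInv_mem_ball {q : ℂ × ℂ} (hq : ε'⁻¹ < ‖realify q‖) :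
    InPuncturedChartBall p ε' (χ q) := by
  refine ⟨?_, ?_⟩
  · rw [hχ q hq]
    exact flat_symm_mem_source hε' hball hq
  · rw [hχ q hq, extChartAt_flat_symm hε' hball hq, Metric.mem_ball, dist_eq_norm,
      add_sub_cancel_left]
    exact norm_inversion_realify_lt_of_lt hε' hq

/-- `Ycoord ∘ χ = id` on the standard end. -/
theorem Ycoord_flatInv {q : ℂ × ℂ} (hq : ε'⁻¹ < ‖realify q‖) : Ycoord p (χ q) = q := by
  apply realify_injective
  rw [realify_Ycoord, hχ q hq, extChartAt_flat_symm hε' hball hq, add_sub_cancel_left,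
    inversion_inversion]

omit hball in
/-- `χ ∘ Ycoord = id` on the punctured `ε'`-chart-ball. -/
theorem flatInv_Ycoord {x : punctured p} (hx : InPuncturedChartBall p ε' x) :
    χ (Ycoord p x) = x := by
  apply Subtype.ext
  rw [hχ _ (Ycoord_mem_stdEnd hε' hx), realify_Ycoord, inversion_inversion, add_sub_cancel]
  exact (extChartAt (𝓡 4) p).left_inv (by rw [extChartAt_source]; exact hx.1)

/-- Such a `χ` is `C^∞` on the standard end (into the open submanifold `Σ ∖ p`). -/
theorem contMDiffOn_flatInv :
    ContMDiffOn 𝓘(ℝ, ℂ × ℂ) (𝓡 4) ∞ χ {q : ℂ × ℂ | ε'⁻¹ < ‖realify q‖} := by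
  intro q hq
  rw [← ContMDiffWithinAt.subtypeVal_comp_iff]
  exact (contMDiffOn_flat_symm hε' hball q hq).congr (fun q' hq' => hχ q' hq') (hχ q hq)

end Inverse

/-! ### The sub-stub -/

/-- **Sub-stub `substub_flatChart` of `stub_pencilOrRescale`: the flat end chart.** For `0 < ε'`
with the closed `ε'`-ball inside the chart target, the complex flat coordinates `Ycoord p` form an
open partial homeomorphism `Φ` of the punctured `ε'`-chart-ball onto the standard end
`{q | ε'⁻¹ < ‖realify q‖}` of `ℂ × ℂ`, with inverse `q ↦ e.symm (e p + ι (realify q))`, both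
smooth (`C^∞`), and `realify ∘ DΦ(x) = Dι(e x − e p) ∘ D(e ∘ val)(x)`.
(Line `Sketch`, `Lines/Sketch.md`, paragraph on the flat coordinates.) -/
theorem substub_flatChart :
    ∀ (S : HomotopySphere 4) (p : S.carrier) (ε' : ℝ), 0 < ε' →
      Metric.closedBall (extChartAt (𝓡 4) p p) ε' ⊆ (extChartAt (𝓡 4) p).target →
      ∃ Φ : OpenPartialHomeomorph (punctured p) (ℂ × ℂ),
        Φ.source = {x | InPuncturedChartBall p ε' x} ∧
        Φ.target = {q | ε'⁻¹ < ‖realify q‖} ∧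
        (∀ x : punctured p, Φ x = Ycoord p x) ∧
        (∀ q ∈ Φ.target, (Φ.symm q).1 = (extChartAt (𝓡 4) p).symm (extChartAt (𝓡 4) p p + inversion (realify q))) ∧
        ContMDiffOn (𝓡 4) 𝓘(ℝ, ℂ × ℂ) ∞ Φ Φ.source ∧
        ContMDiffOn 𝓘(ℝ, ℂ × ℂ) (𝓡 4) ∞ Φ.symm Φ.target ∧
        (∀ x ∈ Φ.source, ∀ v : TangentSpace (𝓡 4) x,
          realify (mfderiv (𝓡 4) 𝓘(ℝ, ℂ × ℂ) Φ x v) =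
            fderiv ℝ inversion (extChartAt (𝓡 4) p x.1 - extChartAt (𝓡 4) p p)
              (mfderiv (𝓡 4) 𝓘(ℝ, EuclideanSpace ℝ (Fin 4)) (fun z : punctured p => extChartAt (𝓡 4) p z.1) x v)) := by
  intro S p ε' hε' hball
  obtain ⟨χ, hχ⟩ := exists_flatInv hε' hball
  refine ⟨{ toFun := Ycoord p
            invFun := χ
            source := {x | InPuncturedChartBall p ε' x}
            target := {q | ε'⁻¹ < ‖realify q‖}
            map_source' := fun _ hx => Ycoord_mem_stdEnd hε' hx
            map_target' := fun _ hq => flatInv_mem_ball hε' hball hχ hq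
            left_inv' := fun _ hx => flatInv_Ycoord hε' hχ hx
            right_inv' := fun _ hq => Ycoord_flatInv hε' hball hχ hq
            open_source :=
              (gromov_recognitionR4_relEnd.isOpen_chartBall p ε').preimage continuous_subtype_val
            open_target := isOpen_stdEnd ε'
            continuousOn_toFun := (contMDiffOn_Ycoord p ε').continuousOn
            continuousOn_invFun := (contMDiffOn_flatInv hε' hball hχ).continuousOn },
    rfl, rfl, fun _ => rfl, fun _ hq => hχ _ hq, contMDiffOn_Ycoord p ε',
    contMDiffOn_flatInv hε' hball hχ, fun _ hx v => realify_mfderiv_Ycoord hx v⟩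

end Summit.SmoothPoincare4.SmoothPoincare4.Theorems.WitnessCharge.PencilIncompleteness
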